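import Literature.NumberTheory.CubicFields.ShintaniCoeffPositivity
import HarnessLib

/-!
# `h(D) > 0` iff `D ≡ 0, 1 (mod 4)`: the support of the Shintani coefficients

Topic `Literature/NumberTheory/CubicFields`; a complement to `ShintaniZeta.lean`
(`classNumber_eq_zero_of_emod_four`: `h(D) = 0` unless `D ≡ 0, 1 (mod 4)`) and
`ShintaniCoeffPositivity.lean` (`a(D) > 0 ⇔ h(D) > 0`).

Bhargava–Taniguchi–Thorne 2023, §2.4 (11), (22): the coefficients `a^±(n)`, `h(±n)` of Shintani's zeta
functions are supported on the discriminants of integral binary cubic forms, i.e. (Stickelberger)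
on `D ≡ 0, 1 (mod 4)`; conversely every such `D` is a discriminant: `Disc(u²v − (D/4)v³) = D` for
`4 ∣ D` and `Disc(u²v + uv² + ((1 − D)/4)v³) = D` for `D ≡ 1 (mod 4)`. Hence, for `D ≠ 0`:

* `exists_disc_eq_of_emod_four` — a reducible form of each discriminant `D ≡ 0, 1 (mod 4)`;
* **`classNumber_pos_iff`** — `h(D) > 0 ⇔ D ≡ 0, 1 (mod 4)`;
* **`shintaniCoeff_pos_iff`** — `a(D) > 0 ⇔ D ≡ 0, 1 (mod 4)`.

## References

* M. Bhargava, T. Taniguchi, F. Thorne, *Improved error estimates for the Davenport–Heilbronn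
  theorems*, Math. Ann. 389 (2024) = arXiv:2107.12819, §2.4 (11), (22) [BhargavaTaniguchiThorne2023].
-/

namespace Literature.NumberTheory.CubicFields

open BinaryCubic RingOfForm

/-- **Every `D ≡ 0, 1 (mod 4)` is the discriminant of a (reducible) integral binary cubic form**:
`(0, 1, 0, −D/4)` resp. `(0, 1, 1, (1 − D)/4)` (`Disc(0, 1, c, d) = c² − 4d`). [folklore] -/
theorem exists_disc_eq_of_emod_four {D : ℤ} (hD : D % 4 = 0 ∨ D % 4 = 1) : ∃ f : BinaryCubic ℤ, f.disc = D := by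
  rcases hD with h | h
  · refine ⟨⟨0, 1, 0, -(D / 4)⟩, ?_⟩
    rw [disc_reducibleNormalForm]
    omega
  · refine ⟨⟨0, 1, 1, (1 - D) / 4⟩, ?_⟩
    rw [disc_reducibleNormalForm]
    omega

/-- **`h(D) > 0` iff `D ≡ 0, 1 (mod 4)`** (`D ≠ 0`). [cite: BhargavaTaniguchiThorne2023, §2.4 (22) (h(n) counts GL₂(ℤ)-orbits of discriminant n, nonzero exactly for n ≡ 0, 1 mod 4)] -/
theorem classNumber_pos_iff {D : ℤ} (hD : D ≠ 0) : 0 < classNumber D ↔ (D % 4 = 0 ∨ D % 4 = 1) := by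
  constructor
  · intro hpos
    by_contra h
    have h23 : D % 4 = 2 ∨ D % 4 = 3 := by omega
    rw [classNumber_eq_zero_of_emod_four h23] at hpos
    exact lt_irrefl 0 hpos
  · intro h
    obtain ⟨f, hf⟩ := exists_disc_eq_of_emod_four h
    haveI := finite_orbitsOfDisc hD
    rw [classNumber, Nat.card_pos_iff]
    exact ⟨⟨⟨gl2zOrbit f, f, rfl, hf⟩⟩, inferInstance⟩

/-- **`a(D) > 0` iff `D ≡ 0, 1 (mod 4)`** (`D ≠ 0`): the support of the Dirichlet coefficients of
Shintani's zeta functions. [folklore] -/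
theorem shintaniCoeff_pos_iff {D : ℤ} (hD : D ≠ 0) :
    (∃ r : ℝ, shintaniCoeffWith (fun _ => 1) D = r ∧ 0 < r) ↔ (D % 4 = 0 ∨ D % 4 = 1) := by
  rw [shintaniCoeffWith_one_pos_iff_classNumber_pos hD, classNumber_pos_iff hD]

/-- For instance `h(−23) > 0` (indeed `x³ − x − 1` has discriminant `−23`). [folklore] -/
example : 0 < classNumber (-23) := (classNumber_pos_iff (by norm_num)).mpr (Or.inr (by norm_num))

end Literature.NumberTheory.CubicFields
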